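import Mathlib.Order.Fin.Basic
import Mathlib.Data.Rat.Cast.Order
import Literature.NumberTheory.LFunctions.JensenHermite
import HarnessLib

/-!
# Decidable hyperbolicity certificates for Jensen polynomials, and the
# "asymptotic tail + certified finite range ⇒ all shifts" composition

The fixed-degree route to the hyperbolicity of the Jensen polynomials
`J^{d,n}_γ(X) = Σ_{j ≤ d} (d choose j) γ(n+j) X^j` (`Literature.NumberTheory.LFunctions.jensenPoly`)
of a positive sequence `γ` — Griffin–Ono–Rolen–Zagier, PNAS 116 (2019), Thm. 2 and §5.2 for the
Taylor coefficients of `ξ` and `d ≤ 8`; Larson–Wagner for the partition function — has one shape: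

* an ASYMPTOTIC TAIL "`J^{d,n}_γ` is hyperbolic for every `n ≥ M`" (GORZ Thm. 3 made effective:
  §5.2, "we determined numbers `M_{ε_d}` for which the required inequalities hold for `n ≥ M_{ε_d}`",
  `M_{ε_4} = 104`), typed here as the named proposition `JensenHyperbolicFrom γ d M`;
* a FINITE CHECK of the shifts `n < M` ("We have confirmed the hyperbolicity … for `n ≤ 10⁶` and
  `4 ≤ d ≤ 8` using Hermite's criterion"), replaced here by a DECIDABLE CERTIFICATE: rational
  enclosures `lo k ≤ γ(k) ≤ hi k` of the coefficients (a `JensenCoeffBox`) and, per shift `n`,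
  `d + 1` rational points `u₀ < u₁ < ⋯ < u_d` at which the interval evaluation of `J^{d,n}_γ` has
  certified, alternating signs (`JensenCoeffBox.Certifies`, a decidable `Prop`; Boolean form
  `JensenCoeffBox.check`). By the intermediate value theorem such a polynomial has `d` distinct real
  roots, hence splits over `ℝ` (`JensenCoeffBox.splits_of_certifies`, from the tree's
  `exists_roots_of_alternating` and `splits_of_roots`).

The composition is `jensenPoly_splits_allShifts_of_from_of_certifiesRange`:
`JensenHyperbolicFrom γ d M → B.Encloses γ → B.CertifiesRange d M U → ∀ n, (J^{d,n}_γ).Splits`.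

Everything is generic in `γ : ℕ → ℝ`: for `γ = xiTaylorCoeff` the enclosure hypothesis
`B.Encloses xiTaylorCoeff` is certified numerics (dischargeable in the kernel for small indices
through `xiTaylorCoeff_eq_xiMoment` and the validated `Φ`-moment enclosures of
`WangYang2024/TuranCertificate.lean`; see `JensenXiFixedDegree.lean`); for integer sequences such
as `p(n)` one takes `lo = hi = γ`.

Certificate format (for external generators; mirrored by `check`): `lo, hi : List ℚ` indexed by the
coefficient index `k` (entries beyond `min |lo| |hi|` are absent); a certificate for `(d, n)` is a
vector `u : Fin (d+1) → ℚ`; it is ACCEPTED iff `n + d < min |lo| |hi|`, `u` is strictly increasing,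
and for each consecutive pair the certified signs (`+1` if the lower interval bound of `J(uᵢ)` is
`> 0`, `-1` if the upper bound is `< 0`, else `0`) multiply to `-1`. The interval bounds are the
termwise ones: `(d choose j) uʲ · lo(n+j)` or `· hi(n+j)` according to the sign of `(d choose j) uʲ`.

What is NOT here: no statement about `ξ` (that is `JensenXiFixedDegree.lean`), no claim that a
certificate exists (hyperbolic polynomials with a multiple root have none), no converse.

## References
* [GORZPNAS2019] M. Griffin, K. Ono, L. Rolen, D. Zagier, PNAS 116 (2019) 11103–11110, Thms. 1–3, §5.2.
* [Moore1979] R. E. Moore, *Methods and Applications of Interval Analysis*, SIAM 1979, Ch. 3,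
  Thm. 3.1 (an inclusion-monotonic interval extension encloses the range — here for the linear form
  `γ ↦ Σ cⱼ γ(n+j)` on the coefficient box).
* [Szego1939] G. Szegő, *Orthogonal Polynomials*, AMS Coll. Publ. 23, §3.3 (5)–(6) (counting real
  zeros by strict sign changes; the same principle as the tree's
  `Literature/Analysis/ValidatedNumerics/SignChangeRootIsolation.lean`).
-/

open Polynomial Finset

namespace Literature.NumberTheory.LFunctions

/-! ## The asymptotic tail as a named proposition -/

/-- **"`J^{d,n}_γ` is hyperbolic for every shift `n ≥ M`"** — the conclusion of an (effective)
large-shift theorem, e.g. GORZ 2019 Thm. 1 (`∃ M`) / §5.2 (`M_{ε_4} = 104`, `M_{ε_d} < 10⁶` for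
`d ≤ 8`) for `γ = xiTaylorCoeff`; used as a NAMED HYPOTHESIS by the composition theorem below.
[cite: GORZPNAS2019, Thm. 1 and §5.2] -/
def JensenHyperbolicFrom (γ : ℕ → ℝ) (d M : ℕ) : Prop :=
  ∀ n : ℕ, M ≤ n → (jensenPoly γ d n).Splits

/-- **"`J^{d,n}_γ` is hyperbolic for every shift `n < M`"** — the finite range a certificate (or a
computer check, GORZ §5.2: "`n ≤ 10⁶` … using Hermite's criterion") has to cover.
[cite: GORZPNAS2019, §5.2] -/
def JensenHyperbolicBelow (γ : ℕ → ℝ) (d M : ℕ) : Prop :=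
  ∀ n : ℕ, n < M → (jensenPoly γ d n).Splits

/-- Tail from `M` and the finite range below `M` give all shifts (the structure of the proof of
GORZ Thm. 2). [cite: GORZPNAS2019, Thm. 2 and §5.2] -/
theorem jensenPoly_splits_allShifts_of_from_of_below {γ : ℕ → ℝ} {d M : ℕ}
    (hA : JensenHyperbolicFrom γ d M) (hB : JensenHyperbolicBelow γ d M) (n : ℕ) :
    (jensenPoly γ d n).Splits := by
  rcases lt_or_ge n M with h | h
  · exact hB n h
  · exact hA n h

/-- GORZ Thm. 1's `∃ N` form is the existence of some tail. [cite: GORZPNAS2019, Thm. 1] -/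
theorem exists_jensenHyperbolicFrom_iff (γ : ℕ → ℝ) (d : ℕ) :
    (∃ M, JensenHyperbolicFrom γ d M) ↔ ∃ N : ℕ, ∀ n : ℕ, N ≤ n → (jensenPoly γ d n).Splits :=
  Iff.rfl

/-! ## Evaluation of a Jensen polynomial -/

/-- `J^{d,n}_γ(x) = Σ_{j ≤ d} (d choose j) γ(n+j) xʲ`. [cite: GORZPNAS2019, §1 eq. (2)] -/
theorem eval_jensenPoly (γ : ℕ → ℝ) (d n : ℕ) (x : ℝ) :
    (jensenPoly γ d n).eval x = ∑ j ∈ range (d + 1), (d.choose j : ℝ) * γ (n + j) * x ^ j := by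
  simp [jensenPoly, eval_finsetSum]

/-- Shifting the sequence shifts the Jensen polynomials: `J^{d,n₀+n}_γ = J^{d,n}_{γ(n₀+·)}` (GORZ §1:
the shift is the passage to the derivative sequence) — a box for `γ(n₀), γ(n₀+1), …` certifies the
shifts `≥ n₀` of `γ` as the shifts `≥ 0` of `k ↦ γ(n₀+k)`. [cite: GORZPNAS2019, §1 eq. (2)] -/
theorem jensenPoly_shift (γ : ℕ → ℝ) (d n₀ n : ℕ) :
    jensenPoly γ d (n₀ + n) = jensenPoly (fun k => γ (n₀ + k)) d n := by
  simp [jensenPoly, add_assoc]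

/-- `deg J^{d,n}_γ ≤ d`. [cite: GORZPNAS2019, §1] -/
private theorem natDegree_jensenPoly_le_aux (γ : ℕ → ℝ) (d n : ℕ) :
    (jensenPoly γ d n).natDegree ≤ d := by
  unfold jensenPoly
  refine natDegree_sum_le_of_forall_le _ _ fun j hj => (natDegree_C_mul_X_pow_le _ _).trans ?_
  simpa [Nat.lt_succ_iff] using hj

/-! ## Coefficient boxes and interval evaluation -/

/-- A box of rational enclosures for the coefficients: `lo k ≤ γ(k) ≤ hi k` for `k < size`
(lists indexed by the coefficient index) — an interval vector in the sense of interval analysis.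
[cite: Moore1979, Ch. 3, Thm. 3.1] -/
structure JensenCoeffBox where
  /-- lower bounds `lo k ≤ γ k` -/
  lo : List ℚ
  /-- upper bounds `γ k ≤ hi k` -/
  hi : List ℚ

namespace JensenCoeffBox

/-- Number of enclosed coefficients. [folklore] -/
def size (B : JensenCoeffBox) : ℕ := min B.lo.length B.hi.length

/-- The box encloses the sequence `γ` on the indices `k < size` (membership of the real vector in
the interval vector). For `γ = xiTaylorCoeff` this is the certified-numerics input (a named
hypothesis unless discharged). [cite: Moore1979, Ch. 3, Thm. 3.1] -/
def Encloses (B : JensenCoeffBox) (γ : ℕ → ℝ) : Prop :=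
  ∀ k : ℕ, k < B.size → ((B.lo.getD k 0 : ℚ) : ℝ) ≤ γ k ∧ γ k ≤ ((B.hi.getD k 0 : ℚ) : ℝ)

/-- Lower bound of the term `(d choose j) γ(n+j) xʲ` on the box. [folklore] -/
def termLower (B : JensenCoeffBox) (d n j : ℕ) (x : ℚ) : ℚ :=
  if 0 ≤ (d.choose j : ℚ) * x ^ j then (d.choose j : ℚ) * x ^ j * B.lo.getD (n + j) 0
  else (d.choose j : ℚ) * x ^ j * B.hi.getD (n + j) 0

/-- Upper bound of the term `(d choose j) γ(n+j) xʲ` on the box. [folklore] -/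
def termUpper (B : JensenCoeffBox) (d n j : ℕ) (x : ℚ) : ℚ :=
  if 0 ≤ (d.choose j : ℚ) * x ^ j then (d.choose j : ℚ) * x ^ j * B.hi.getD (n + j) 0
  else (d.choose j : ℚ) * x ^ j * B.lo.getD (n + j) 0

/-- Lower bound of `J^{d,n}_γ(x)` on the box (termwise interval arithmetic). [folklore] -/
def evalLower (B : JensenCoeffBox) (d n : ℕ) (x : ℚ) : ℚ :=
  ∑ j ∈ range (d + 1), B.termLower d n j x

/-- Upper bound of `J^{d,n}_γ(x)` on the box (termwise interval arithmetic). [folklore] -/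
def evalUpper (B : JensenCoeffBox) (d n : ℕ) (x : ℚ) : ℚ :=
  ∑ j ∈ range (d + 1), B.termUpper d n j x

/-- Certified sign of `J^{d,n}_γ(x)` on the box: `1` (certainly positive), `-1` (certainly
negative), `0` (undecided). [folklore] -/
def signAt (B : JensenCoeffBox) (d n : ℕ) (x : ℚ) : ℤ :=
  if 0 < B.evalLower d n x then 1 else if B.evalUpper d n x < 0 then -1 else 0

/-- **The certificate predicate** for `(d, n)` with sign points `u : Fin (d+1) → ℚ`: the box covers
`γ(n), …, γ(n+d)`, the points increase strictly, and consecutive certified signs are opposite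
(`d` strict sign changes of a degree-`≤ d` polynomial). Decidable; prove instances by `decide` /
`decide +kernel`. [cite: Szego1939, §3.3 (5)–(6)] -/
def Certifies (B : JensenCoeffBox) (d n : ℕ) (u : Fin (d + 1) → ℚ) : Prop :=
  n + d < B.size ∧ (∀ i : Fin d, u i.castSucc < u i.succ) ∧
    ∀ i : Fin d, B.signAt d n (u i.castSucc) * B.signAt d n (u i.succ) = -1

/-- `Certifies` is decidable (rational arithmetic). [folklore] -/
instance (B : JensenCoeffBox) (d n : ℕ) (u : Fin (d + 1) → ℚ) : Decidable (B.Certifies d n u) := by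
  unfold Certifies; infer_instance

/-- Boolean form of `Certifies` (the checker external tools mirror). [folklore] -/
def check (B : JensenCoeffBox) (d n : ℕ) (u : Fin (d + 1) → ℚ) : Bool :=
  decide (B.Certifies d n u)

/-- `check = true ↔ Certifies`. [cite: Szego1939, §3.3 (5)–(6)] -/
theorem check_eq_true_iff (B : JensenCoeffBox) (d n : ℕ) (u : Fin (d + 1) → ℚ) :
    B.check d n u = true ↔ B.Certifies d n u :=
  decide_eq_true_iff

/-- **Range certificate**: one sign-point vector per shift `n < M`. [cite: Szego1939, §3.3 (5)–(6)] -/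
def CertifiesRange (B : JensenCoeffBox) (d M : ℕ) (U : Fin M → Fin (d + 1) → ℚ) : Prop :=
  ∀ m : Fin M, B.Certifies d m (U m)

/-- `CertifiesRange` is decidable. [folklore] -/
instance (B : JensenCoeffBox) (d M : ℕ) (U : Fin M → Fin (d + 1) → ℚ) :
    Decidable (B.CertifiesRange d M U) := by
  unfold CertifiesRange; infer_instance

/-! ## Soundness -/

variable {γ : ℕ → ℝ} {B : JensenCoeffBox}

/-- Termwise lower bound. [folklore] -/
private theorem termLower_le (hB : B.Encloses γ) {d n j : ℕ} (hj : n + j < B.size) (x : ℚ) :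
    ((B.termLower d n j x : ℚ) : ℝ) ≤ (d.choose j : ℝ) * γ (n + j) * (x : ℝ) ^ j := by
  obtain ⟨hlo, hhi⟩ := hB (n + j) hj
  unfold termLower
  split_ifs with hc
  · have hc' : (0 : ℝ) ≤ (d.choose j : ℝ) * (x : ℝ) ^ j := by exact_mod_cast hc
    push_cast
    calc (d.choose j : ℝ) * (x : ℝ) ^ j * ((B.lo.getD (n + j) 0 : ℚ) : ℝ)
        ≤ (d.choose j : ℝ) * (x : ℝ) ^ j * γ (n + j) := mul_le_mul_of_nonneg_left hlo hc'
      _ = _ := by ring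
  · have hc' : (d.choose j : ℝ) * (x : ℝ) ^ j ≤ 0 := by exact_mod_cast (not_le.1 hc).le
    push_cast
    calc (d.choose j : ℝ) * (x : ℝ) ^ j * ((B.hi.getD (n + j) 0 : ℚ) : ℝ)
        ≤ (d.choose j : ℝ) * (x : ℝ) ^ j * γ (n + j) := mul_le_mul_of_nonpos_left hhi hc'
      _ = _ := by ring

/-- Termwise upper bound. [folklore] -/
private theorem le_termUpper (hB : B.Encloses γ) {d n j : ℕ} (hj : n + j < B.size) (x : ℚ) :
    (d.choose j : ℝ) * γ (n + j) * (x : ℝ) ^ j ≤ ((B.termUpper d n j x : ℚ) : ℝ) := by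
  obtain ⟨hlo, hhi⟩ := hB (n + j) hj
  unfold termUpper
  split_ifs with hc
  · have hc' : (0 : ℝ) ≤ (d.choose j : ℝ) * (x : ℝ) ^ j := by exact_mod_cast hc
    push_cast
    calc (d.choose j : ℝ) * γ (n + j) * (x : ℝ) ^ j
        = (d.choose j : ℝ) * (x : ℝ) ^ j * γ (n + j) := by ring
      _ ≤ (d.choose j : ℝ) * (x : ℝ) ^ j * ((B.hi.getD (n + j) 0 : ℚ) : ℝ) :=
          mul_le_mul_of_nonneg_left hhi hc'
  · have hc' : (d.choose j : ℝ) * (x : ℝ) ^ j ≤ 0 := by exact_mod_cast (not_le.1 hc).le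
    push_cast
    calc (d.choose j : ℝ) * γ (n + j) * (x : ℝ) ^ j
        = (d.choose j : ℝ) * (x : ℝ) ^ j * γ (n + j) := by ring
      _ ≤ (d.choose j : ℝ) * (x : ℝ) ^ j * ((B.lo.getD (n + j) 0 : ℚ) : ℝ) :=
          mul_le_mul_of_nonpos_left hlo hc'

/-- `evalLower ≤ J^{d,n}_γ(x)` on the box: the interval evaluation of the linear form
`γ ↦ Σ (d choose j) xʲ γ(n+j)` encloses its range on the box (fundamental theorem of interval
arithmetic). [cite: Moore1979, Ch. 3, Thm. 3.1] -/
theorem evalLower_le (hB : B.Encloses γ) {d n : ℕ} (hnd : n + d < B.size) (x : ℚ) :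
    ((B.evalLower d n x : ℚ) : ℝ) ≤ (jensenPoly γ d n).eval (x : ℝ) := by
  rw [eval_jensenPoly, evalLower, Rat.cast_sum]
  refine Finset.sum_le_sum fun j hj => termLower_le hB ?_ x
  have := Finset.mem_range.1 hj
  omega

/-- `J^{d,n}_γ(x) ≤ evalUpper` on the box. [cite: Moore1979, Ch. 3, Thm. 3.1] -/
theorem le_evalUpper (hB : B.Encloses γ) {d n : ℕ} (hnd : n + d < B.size) (x : ℚ) :
    (jensenPoly γ d n).eval (x : ℝ) ≤ ((B.evalUpper d n x : ℚ) : ℝ) := by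
  rw [eval_jensenPoly, evalUpper, Rat.cast_sum]
  refine Finset.sum_le_sum fun j hj => le_termUpper hB ?_ x
  have := Finset.mem_range.1 hj
  omega

/-- A certified sign `+1` means `J^{d,n}_γ(x) > 0`. [folklore] -/
private theorem eval_pos_of_signAt_eq_one (hB : B.Encloses γ) {d n : ℕ} (hnd : n + d < B.size) {x : ℚ}
    (h : B.signAt d n x = 1) : 0 < (jensenPoly γ d n).eval (x : ℝ) := by
  have h1 : 0 < B.evalLower d n x := by
    by_contra hc
    unfold signAt at h
    rw [if_neg hc] at h
    by_cases h2 : B.evalUpper d n x < 0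
    · rw [if_pos h2] at h; omega
    · rw [if_neg h2] at h; omega
  exact lt_of_lt_of_le (by exact_mod_cast h1) (evalLower_le hB hnd x)

/-- A certified sign `-1` means `J^{d,n}_γ(x) < 0`. [folklore] -/
private theorem eval_neg_of_signAt_eq_neg_one (hB : B.Encloses γ) {d n : ℕ} (hnd : n + d < B.size)
    {x : ℚ} (h : B.signAt d n x = -1) : (jensenPoly γ d n).eval (x : ℝ) < 0 := by
  have h2 : B.evalUpper d n x < 0 := by
    by_contra hc
    unfold signAt at h
    by_cases h1 : 0 < B.evalLower d n x
    · rw [if_pos h1] at h; omega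
    · rw [if_neg h1, if_neg hc] at h; omega
  exact lt_of_le_of_lt (le_evalUpper hB hnd x) (by exact_mod_cast h2)

/-- Opposite certified signs at two points give a sign change of `J^{d,n}_γ`. [folklore] -/
private theorem eval_mul_eval_neg_of_signAt (hB : B.Encloses γ) {d n : ℕ} (hnd : n + d < B.size)
    {x y : ℚ} (h : B.signAt d n x * B.signAt d n y = -1) :
    (jensenPoly γ d n).eval (x : ℝ) * (jensenPoly γ d n).eval (y : ℝ) < 0 := by
  have hx : B.signAt d n x = 1 ∨ B.signAt d n x = -1 ∨ B.signAt d n x = 0 := by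
    unfold signAt; split_ifs <;> simp
  have hy : B.signAt d n y = 1 ∨ B.signAt d n y = -1 ∨ B.signAt d n y = 0 := by
    unfold signAt; split_ifs <;> simp
  rcases hx with hx | hx | hx <;> rcases hy with hy | hy | hy <;> rw [hx, hy] at h <;> norm_num at h
  · exact mul_neg_of_pos_of_neg (eval_pos_of_signAt_eq_one hB hnd hx)
      (eval_neg_of_signAt_eq_neg_one hB hnd hy)
  · exact mul_neg_of_neg_of_pos (eval_neg_of_signAt_eq_neg_one hB hnd hx)
      (eval_pos_of_signAt_eq_one hB hnd hy)

/-- **Soundness of the certificate**: if the box encloses `γ` and `(d, n, u)` is certified, then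
`J^{d,n}_γ` is hyperbolic (splits over `ℝ`) — by the intermediate value theorem it has `d` roots
strictly interlacing `u₀ < ⋯ < u_d` (`exists_roots_of_alternating`), and a nonzero real polynomial
of degree `≤ d` with `d` distinct roots splits (`splits_of_roots`) — zero counting by strict sign
changes. [cite: Szego1939, §3.3 (5)–(6)] -/
theorem splits_of_certifies (hB : B.Encloses γ) {d n : ℕ} {u : Fin (d + 1) → ℚ}
    (h : B.Certifies d n u) : (jensenPoly γ d n).Splits := by
  obtain ⟨hnd, hmono, halt⟩ := h
  rcases Nat.eq_zero_or_pos d with rfl | hd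
  · have h0 : jensenPoly γ 0 n = C (γ n) := by simp [jensenPoly]
    rw [h0]
    exact Splits.C _
  · set P := jensenPoly γ d n with hP
    have hu : StrictMono (fun i : Fin (d + 1) => ((u i : ℚ) : ℝ)) :=
      Fin.strictMono_iff_lt_succ.2 fun i => by exact_mod_cast hmono i
    have halt' : ∀ i : Fin d,
        P.eval (((u i.castSucc : ℚ)) : ℝ) * P.eval (((u i.succ : ℚ)) : ℝ) < 0 :=
      fun i => eval_mul_eval_neg_of_signAt hB hnd (halt i)
    obtain ⟨t, ht, -, hroot⟩ :=
      exists_roots_of_alternating P (fun i : Fin (d + 1) => ((u i : ℚ) : ℝ)) hu halt'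
    have hP0 : P ≠ 0 := by
      intro h0
      have := halt' ⟨0, hd⟩
      rw [h0] at this
      simp at this
    exact (splits_of_roots hP0 (natDegree_jensenPoly_le_aux γ d n) t ht.injective hroot).1

/-- Boolean form of soundness. [cite: Szego1939, §3.3 (5)–(6)] -/
theorem splits_of_check (hB : B.Encloses γ) {d n : ℕ} {u : Fin (d + 1) → ℚ}
    (h : B.check d n u = true) : (jensenPoly γ d n).Splits :=
  splits_of_certifies hB ((B.check_eq_true_iff d n u).1 h)

/-- **Soundness of a range certificate**: the finite range `n < M` is hyperbolic.
[cite: Szego1939, §3.3 (5)–(6)] -/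
theorem jensenHyperbolicBelow_of_certifiesRange (hB : B.Encloses γ) {d M : ℕ}
    {U : Fin M → Fin (d + 1) → ℚ} (h : B.CertifiesRange d M U) : JensenHyperbolicBelow γ d M :=
  fun n hn => splits_of_certifies hB (h ⟨n, hn⟩)

end JensenCoeffBox

/-! ## The composition: asymptotic tail + certified finite range ⇒ every shift -/

/-- **Fixed degree, all shifts, certificate shape.** If `J^{d,n}_γ` is hyperbolic for every
`n ≥ M` (named asymptotic input), the box `B` encloses `γ`, and the range certificate for the shifts
`n < M` is accepted (decidable), then `J^{d,n}_γ` is hyperbolic for EVERY shift `n`. This is the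
structure of GORZ 2019, Thm. 2 (`d ≤ 8`: effective tail `n ≥ M_{ε_d}` + computer check below `10⁶`),
with the computer check replaced by a kernel-checkable certificate. [cite: GORZPNAS2019, Thm. 2 and §5.2] -/
theorem jensenPoly_splits_allShifts_of_from_of_certifiesRange {γ : ℕ → ℝ} {d M : ℕ}
    (hA : JensenHyperbolicFrom γ d M) {B : JensenCoeffBox} (hB : B.Encloses γ)
    {U : Fin M → Fin (d + 1) → ℚ} (hC : B.CertifiesRange d M U) (n : ℕ) :
    (jensenPoly γ d n).Splits :=
  jensenPoly_splits_allShifts_of_from_of_below hA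
    (JensenCoeffBox.jensenHyperbolicBelow_of_certifiesRange hB hC) n

/-! ## A kernel smoke test of the checker (toy data)

The box `lo = hi = [1, 3, 1]` (so `J^{2,0} = 1 + 6X + X²`, roots `-3 ± 2√2`) with sign points
`-7 < -1 < 0` (`J = 8, -4, 1`) is accepted by `decide`; hence every `γ` with `γ 0 = 1`, `γ 1 = 3`,
`γ 2 = 1` has `J^{2,0}_γ` hyperbolic. -/

/-- Toy box `γ(0..2) = (1, 3, 1)` exactly. [folklore] -/
def JensenCoeffBox.toy : JensenCoeffBox := ⟨[1, 3, 1], [1, 3, 1]⟩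

/-- The toy certificate is accepted (kernel evaluation of the checker). [folklore] -/
private theorem JensenCoeffBox.toy_certifies : JensenCoeffBox.toy.Certifies 2 0 ![-7, -1, 0] := by
  decide +kernel

/-- Hence `J^{2,0}_γ` splits for every `γ` the toy box encloses (smoke test of the pipeline).
[folklore] -/
example {γ : ℕ → ℝ} (hγ : JensenCoeffBox.toy.Encloses γ) : (jensenPoly γ 2 0).Splits :=
  JensenCoeffBox.splits_of_certifies hγ JensenCoeffBox.toy_certifies

end Literature.NumberTheory.LFunctions
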